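import Literature.AlgebraicGeometry.Motives.AdaptedAlgebraicCharts
import Mathlib.Analysis.Calculus.InverseFunctionTheorem.FDeriv
import HarnessLib

/-!
# Ring 2 · sub-cell AbelianAll (ALL ABELIAN VARIETIES), André axis, part XIII-c — along a smooth morphism,
# a LINEAR projection of the algebraic coordinates of the total space is injective on the nearby fibres

HONEST FRAMING (page 1, verbatim): **research route, not a corollary; conditional on HC_CM plus one named
minimal statement.** Cell line: research route conditional on HC_CM; not a corollary; Q11.4-sentence-2
already refuted in dim ≥ 3. Nothing in this file proves a case of the Hodge conjecture. Seat
`pub-hodge-ring2-ab-andre-2`, gen 5 (towards the discharge of the supply node (φ)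
`FibreClassConstantCompactPencils` = lit's named fact `HodgeTheory.Fulton1998_map_fundamentalClass_fibre_eq`).

Let `g : X ⟶ Y` be a smooth morphism of `ℂ`-schemes smooth over `ℂ` of relative dimensions `n`, `m` and
locally of finite type, `P ∈ X(ℂ)`, and `a_P : X(ℂ) ⇀ ℂⁿ` the holomorphic algebraic chart at `P`
(`Motives.ComplexPoints.algebraicChart`, Serre GAGA §2 n°5). The holomorphic normal form of a submersion
(Voisin, *Hodge Theory I*, §9.1.1; the tree's `Motives.exists_adaptedChart` is the real-`C^∞` version with
boundary divisors) in the minimal form needed to compare the complex orientations of the fibres of `g`: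

* `exists_fibrewise_injOn_linear_chart` — **there are an open `W ∋ P` inside `a_P.source` and a `ℂ`-LINEAR
  map `p : ℂⁿ → ℂᵈ`, `d + m = n`, such that `y ↦ (g(ℂ) y, p (a_P y))` is injective on `W`**: in the chart
  the map `g(ℂ)` is holomorphic with onto differential at `a_P P` (`Motives.surjective_fderiv_chart_map`,
  SGA1 XII Prop. 3.1 (iv)); complete the differential by a projection `p` onto its kernel (dimension
  `n - m = d`) and apply the inverse function theorem to `z ↦ (g z, p z)` (Mathlib's
  `HasStrictFDerivAt.toOpenPartialHomeomorph`).

So `q = p ∘ a_P` is given by `d` LINEAR COMBINATIONS OF REGULAR COORDINATE FUNCTIONS of `X`, hence is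
holomorphic on every fibre of `g` in that fibre's own algebraic charts (GAGA) — the point of keeping `p`
linear rather than straightening `g` completely. Everything is proved; no definitions, no named facts.

## References

* [VoisinHodgeI2002] C. Voisin, Hodge Theory and Complex Algebraic Geometry I, CUP 2002, §9.1.1.
* [SGA1] A. Grothendieck, M. Raynaud, SGA 1, Exp. XII Prop. 3.1 (iv).
* [SerreGAGA1956] J.-P. Serre, GAGA, Ann. Inst. Fourier 6 (1956), §2 n°5 Prop. 2.
-/

noncomputable section

set_option linter.dupNamespace false

namespace Summit.HodgeConjecture.HodgeConjecture.Ring2.AbelianAll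

open CategoryTheory AlgebraicGeometry Set Filter Topology
open scoped ContDiff
open Literature.AlgebraicGeometry Literature.AlgebraicGeometry.Motives

section Submersion

variable {n m : ℕ} {X Y : SchemeOver ℂ} [LocallyOfFiniteType X.hom] [SmoothOfRelativeDimension n X.hom]
  [LocallyOfFiniteType Y.hom] [SmoothOfRelativeDimension m Y.hom]

/-- **Fibrewise-injective linear coordinates along a smooth morphism.** For `g : X ⟶ Y` smooth between
`ℂ`-schemes smooth of relative dimensions `n`, `m` and locally of finite type, `P ∈ X(ℂ)` and `d + m = n`,
there are an open `W ∋ P` contained in the source of the algebraic chart `a_P` of `X(ℂ)` at `P` and a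
`ℂ`-linear `p : ℂⁿ → ℂᵈ` such that `y ↦ (g(ℂ) y, p (a_P y))` is injective on `W` (holomorphic normal form of
the submersion `g(ℂ)`: onto differential in algebraic charts, SGA1 XII 3.1 (iv) / the tree's
`surjective_fderiv_chart_map`, completed by a projection onto its kernel, then the inverse function
theorem). [cite: VoisinHodgeI2002, §9.1.1] [cite: SGA1, Exp. XII Prop. 3.1 (iv)]
[cite: SerreGAGA1956, §2 n°5 Prop. 2] -/
theorem exists_fibrewise_injOn_linear_chart (g : X ⟶ Y) [Smooth g.left] (P : ComplexPoints X) {d : ℕ}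
    (hd : d + m = n) :
    ∃ (W : Set (ComplexPoints X)) (p : (Fin n → ℂ) →L[ℂ] (Fin d → ℂ)),
      IsOpen W ∧ P ∈ W ∧ W ⊆ (ComplexPoints.algebraicChart X n P).source ∧
        InjOn (fun y => (AlgPoints.map g y, p (ComplexPoints.algebraicChart X n P y))) W := by
  classical
  set Q := AlgPoints.map g P with hQdef
  set aX := ComplexPoints.algebraicChart X n P with haX
  set aY := ComplexPoints.algebraicChart Y m Q with haY
  obtain ⟨⟨V₁, u, hsrcY, hu⟩, holY⟩ := ComplexPoints.algebraicChart_spec Y m Q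
  obtain ⟨algX, holX⟩ := ComplexPoints.algebraicChart_spec X n P
  have hP : P ∈ aX.source := ComplexPoints.mem_algebraicChart_source X n P
  have hQ : Q ∈ aY.source := ComplexPoints.mem_algebraicChart_source Y m Q
  have hQV₁ : Q.pt ∈ (↑V₁ : Y.left.Opens) := hsrcY hQ
  obtain ⟨U, hPU, hle, t, htspan⟩ :=
    exists_localCoordinates_le n P (g.left ⁻¹ᵁ ↑V₁) (show P.pt ∈ g.left ⁻¹ᵁ ↑V₁ from hQV₁)
  obtain ⟨hdiff, hsurj⟩ := surjective_fderiv_chart_map g aX hP holX algX aY hQ holY V₁ u hsrcY hu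
    U hPU hle t htspan
  -- the holomorphic chart expression `G` and its onto differential `D` at `z₀ = aX P`
  set G : (Fin n → ℂ) → (Fin m → ℂ) := aY ∘ AlgPoints.map g ∘ aX.symm with hGdef
  set z₀ : Fin n → ℂ := aX P with hz₀
  set D : (Fin n → ℂ) →L[ℂ] (Fin m → ℂ) := fderiv ℂ G z₀ with hD
  -- `G` is holomorphic near `z₀`, hence strictly differentiable there
  set O : Set (Fin n → ℂ) := aX.target ∩ aX.symm ⁻¹' (AlgPoints.map g ⁻¹' aY.source) with hO
  have hOo : IsOpen O := aX.isOpen_inter_preimage_symm (aY.open_source.preimage (AlgPoints.continuous_map g))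
  have hz₀O : z₀ ∈ O := by
    refine ⟨aX.map_source hP, ?_⟩
    rw [mem_preimage, hz₀, aX.left_inv hP]
    exact hQ
  have hGO : ContDiffOn ℂ ω G O := ComplexPoints.contDiffOn_chart_map (n := n) (m := m) g P Q
  have hGstrict : HasStrictFDerivAt G D z₀ :=
    (hGO.contDiffAt (hOo.mem_nhds hz₀O)).hasStrictFDerivAt (by simp)
  -- linear algebra: complete `D` by a projection onto its kernel, of dimension `d`
  let Dl : (Fin n → ℂ) →ₗ[ℂ] (Fin m → ℂ) := (D : (Fin n → ℂ) →ₗ[ℂ] (Fin m → ℂ))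
  have hDsurj : Function.Surjective Dl := fun y => hsurj y
  obtain ⟨J, hJ⟩ := exists_linearEquiv_prod_ker_fst_eq Dl hDsurj
  have hdimK : Module.finrank ℂ (LinearMap.ker Dl) = Module.finrank ℂ (Fin d → ℂ) := by
    have h1 := LinearMap.finrank_range_add_finrank_ker Dl
    rw [LinearMap.range_eq_top.2 hDsurj, finrank_top] at h1
    simp only [Module.finrank_fin_fun] at h1 ⊢
    omega
  set eqv : LinearMap.ker Dl ≃ₗ[ℂ] (Fin d → ℂ) := LinearEquiv.ofFinrankEq _ _ hdimK with heqv
  let pl : (Fin n → ℂ) →ₗ[ℂ] (Fin d → ℂ) :=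
    { toFun := fun v => eqv (J v).2
      map_add' := fun v v' => by simp
      map_smul' := fun c v => by simp }
  set p : (Fin n → ℂ) →L[ℂ] (Fin d → ℂ) := LinearMap.toContinuousLinearMap pl with hp
  have hp_apply : ∀ v, p v = eqv (J v).2 := fun v => rfl
  -- the map `Θ = (G, p)` and its invertible derivative `(D, p) = (id × eqv) ∘ J`
  set Θ : (Fin n → ℂ) → (Fin m → ℂ) × (Fin d → ℂ) := fun z => (G z, p z) with hΘ
  set Jfull : (Fin n → ℂ) ≃ₗ[ℂ] (Fin m → ℂ) × (Fin d → ℂ) :=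
    J.trans (LinearEquiv.prodCongr (LinearEquiv.refl ℂ _) eqv) with hJfull
  have hJfull_apply : ∀ v, Jfull v = (D v, p v) := by
    intro v
    have h1 : (J v).1 = D v := hJ v
    simp only [hJfull, LinearEquiv.trans_apply, LinearEquiv.prodCongr_apply, LinearEquiv.refl_apply,
      hp_apply]
    rw [show J v = ((J v).1, (J v).2) from rfl, h1]
  set Tre : (Fin n → ℂ) ≃L[ℂ] (Fin m → ℂ) × (Fin d → ℂ) := Jfull.toContinuousLinearEquiv with hTre
  have hΘstrict : HasStrictFDerivAt Θ (Tre : (Fin n → ℂ) →L[ℂ] (Fin m → ℂ) × (Fin d → ℂ)) z₀ := by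
    have h := hGstrict.prodMk p.hasStrictFDerivAt
    refine h.congr_fderiv ?_
    ext1 v
    change (D v, p v) = Tre v
    rw [hTre]
    change (D v, p v) = Jfull v
    rw [hJfull_apply]
  -- the inverse function theorem: `Θ` is injective near `z₀`
  set T := hΘstrict.toOpenPartialHomeomorph Θ with hT
  have hz₀T : z₀ ∈ T.source := hΘstrict.mem_toOpenPartialHomeomorph_source
  have hTΘ : ∀ z, T z = Θ z := fun z => rfl
  refine ⟨aX.source ∩ aX ⁻¹' T.source, p, aX.isOpen_inter_preimage T.open_source, ⟨hP, hz₀T⟩,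
    inter_subset_left, ?_⟩
  rintro y ⟨hy, hyT⟩ y' ⟨hy', hy'T⟩ hyy'
  have hg : AlgPoints.map g y = AlgPoints.map g y' := congrArg Prod.fst hyy'
  have hpp : p (aX y) = p (aX y') := congrArg Prod.snd hyy'
  have hΘeq : Θ (aX y) = Θ (aX y') := by
    refine Prod.ext ?_ hpp
    change aY (AlgPoints.map g (aX.symm (aX y))) = aY (AlgPoints.map g (aX.symm (aX y')))
    rw [aX.left_inv hy, aX.left_inv hy', hg]
  have haXeq : aX y = aX y' := by
    apply T.injOn hyT hy'T
    rw [hTΘ, hTΘ]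
    exact hΘeq
  exact aX.injOn hy hy' haXeq

end Submersion

end Summit.HodgeConjecture.HodgeConjecture.Ring2.AbelianAll

end
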